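import Mathlib.RingTheory.Localization.FractionRing
import Mathlib.RingTheory.MvPolynomial.Basic
import Summits.Ventures.HSemireg.WedgeHankelRecurrenceBezoutianHurwitzMinors
import Summits.Ventures.HSemireg.WedgeHankelRecurrenceRouthHurwitzDeterminants

/-!
# Venture HSemireg — THE HURWITZ–BEZOUTIAN MINOR DICTIONARY WITHOUT REGULARITY, BY THE GENERIC POINT: **`det B_j(g, f) = Δ_{2j}(p)` and `det B_{j+1}(f, X·g) = p_0 · Δ_{2j+1}(p)` for ALL
# `p = f(X²) + X·g(X²)` over ANY commutative ring** — N220's regular-case identities are polynomial identities in the coefficients; they hold for the generic pair over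
# `ℤ[f_0, …, f_{N−1}, g_0, …, g_{N−1}]` because its fraction field is a field in which every Hurwitz determinant of the generic polynomial is non-zero (it specialises to the Hurwitz determinant of
# `(1 + X)^{2N−1}`, positive by the Routh–Hurwitz theorem N211), and they specialise to every pair

HONEST FRAMING. Part of the Lean index of the computation cell `pub-hsemireg` (seat p10 gen 39, Sunday typer «UNIFORM-IN-n»).
POLYNOMIAL IDENTITIES BETWEEN DETERMINANTS, TRANSPORTED ALONG RING HOMOMORPHISMS (Mathlib `MvPolynomial`, `FractionRing`, `RingHom.map_det`): no variety, no cohomology theory, no sheaf, no Ext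
group and no semiregularity map is constructed here; nothing here says that HC / HC_CM / HC_AV holds; no Literature fact (unproved `Prop`) is declared or used.  Custodian versions as in
`WedgeHankelSiegelIdeal` (1/3).
SOURCES (cited).  As N220 (Gantmacher Ch. XV §6; Fuhrmann–Helmke Thm 5.55 (iii); Basu–Pollack–Roy Thm 9.30; Lancaster–Tismenetsky §13.8–13.9 for the classical identification); the
generic-point ∕ permanence-of-identities argument is folklore (H. Weyl's «principle of the irrelevance of algebraic inequalities»).
DEDUP DISCLOSURE (`rg`, 2026-09-02): N220 has the regular case over a field; the functoriality lemmas below (`bezoutian_map`, `hurwitzSeqMatrix_map`) and the generic polynomials are new;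
N183 `bezCoeff_map` and N215 `hurwitzMatrix_map` are IMPORTED ∕ parallel, not restated.  The 10 names below: 0 hits tree-wide.

WHAT IS IN THE TREE.  N220: `det_bezoutian_even_odd_eq`, `det_bezoutian_X_mul_eq`; N211: `forall_re_neg_iff_forall_det_hurwitzSeqMatrix_pos`, `eq_expand_contract_add_X_mul_expand_contract`; N210:
`hurwitzSeqMatrix_apply`, `coeff_even_add_odd`; N183: `bezCoeff_map`; Literature `Bezoutian`: `bezoutian_apply`.  Mathlib: `MvPolynomial.eval₂Hom`, `MvPolynomial.eval₂Hom_X'`, `IsFractionRing.injective`,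
`RingHom.map_det`, `Polynomial.map_expand`, `Polynomial.as_sum_range_C_mul_X_pow'`, `Polynomial.coeff_contract`, `Polynomial.coeff_one_add_X_pow`.
THIS FILE (namespace `Summit.Ventures.HSemireg.Wedge.HankelOuter` continued; CHAINED on N220 + N211; 0 definitions):
* §939 FUNCTORIALITY: `bezoutian_map`, `hurwitzSeqMatrix_map`, `map_expand_two_add_X_mul`, `coeff_map_eq_comp`.
* §940 THE GENERIC PAIR over `ℤ[f_i, g_i]` (`i < N`; written inline as `Σ C(x_i) Xⁱ`): `map_sum_C_X_mul_X_pow_eq` (specialisation to any polynomial of degree `< N`), `det_hurwitzSeqMatrix_one_add_X_pow_pos`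
  (the witness: all `Δ_k((1+X)^M) > 0`, `k ≤ M`, by N211), `det_hurwitzSeqMatrix_generic_ne_zero` (every `Δ_k`, `k ≤ 2N − 1`, of the generic pair is a non-zero polynomial), `det_bezoutian_generic`
  (N220's two identities for the generic pair, through the fraction field).
* §941 THE UNCONDITIONAL DICTIONARY (any commutative ring): **`det_bezoutian_eq_det_hurwitzSeqMatrix_two_mul`** (`det B_j(g, f) = Δ_{2j}(f(X²) + Xg(X²))`),
  **`det_bezoutian_X_mul_eq_coeff_zero_mul_det_hurwitzSeqMatrix`** (`det B_{j+1}(f, Xg) = f_0 · Δ_{2j+1}`).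
CAVEATS.  The generic ring is `MvPolynomial (Fin N ⊕ Fin N) ℤ`; `N` is chosen past the degrees and past `j`.  Nothing Ext-side.  New names only.
-/

open Module Polynomial
open scoped Matrix Polynomial

namespace Summit.Ventures.HSemireg.Wedge.HankelOuter

open Summit.Ventures.HSemireg.Wedge Summit.Ventures.HSemireg.Wedge.Hankel
open Literature.LinearAlgebra.Matrix.Bezoutian (bezCoeff bezoutian bezoutian_apply)

/-! ## §939. Functoriality along ring homomorphisms -/

section Functorial

variable {R S : Type*} [CommRing R] [CommRing S] (φ : R →+* S)

/-- `B_n(p, q)^φ = B_n(p^φ, q^φ)` (N183 `bezCoeff_map`, matrix form). [bookkeeping; this file, §939] -/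
theorem bezoutian_map (n : ℕ) (p q : R[X]) : (bezoutian n p q).map φ = bezoutian n (p.map φ) (q.map φ) := by
  ext i j
  rw [Matrix.map_apply, bezoutian_apply, bezoutian_apply, bezCoeff_map]

/-- `H_k(c)^φ = H_k(φ ∘ c)`. [bookkeeping; this file, §939] -/
theorem hurwitzSeqMatrix_map (k : ℕ) (c : ℕ → R) : (hurwitzSeqMatrix k c).map φ = hurwitzSeqMatrix k (φ ∘ c) := by
  ext i j
  rw [Matrix.map_apply, hurwitzSeqMatrix_apply, hurwitzSeqMatrix_apply]
  split_ifs
  · rfl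
  · rw [map_zero]

/-- `(f(X²) + X g(X²))^φ = f^φ(X²) + X g^φ(X²)`. [bookkeeping; this file, §939] -/
theorem map_expand_two_add_X_mul (f g : R[X]) : (expand R 2 f + Polynomial.X * expand R 2 g).map φ = expand S 2 (f.map φ) + Polynomial.X * expand S 2 (g.map φ) := by
  rw [Polynomial.map_add, Polynomial.map_mul, Polynomial.map_X, map_expand, map_expand]

/-- `(p^φ).coeff = φ ∘ p.coeff` as functions. [bookkeeping; this file, §939] -/
theorem coeff_map_eq_comp (p : R[X]) : (p.map φ).coeff = φ ∘ p.coeff := funext fun n => coeff_map φ n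

end Functorial

/-! ## §940. The generic pair and the witness `(1 + X)^{2N−1}` -/

section Generic

/-- **The generic polynomial `Σ_{i<N} x_i Xⁱ` specialises to every `f` of degree `< N`** under `x_i ↦ f_i` (any commutative ring). [bookkeeping; this file, §940] -/
theorem map_sum_C_X_mul_X_pow_eq {K : Type*} [CommRing K] {N : ℕ} {ι : Type*} (e : Fin N → ι) (v : ι → K) (f : K[X]) (hf : f.natDegree < N) (hv : ∀ i : Fin N, v (e i) = f.coeff i) :
    (∑ i : Fin N, Polynomial.C (MvPolynomial.X (e i) : MvPolynomial ι ℤ) * Polynomial.X ^ (i : ℕ)).map (MvPolynomial.eval₂Hom (Int.castRingHom K) v : MvPolynomial ι ℤ →+* K) = f := by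
  rw [Polynomial.map_sum]
  simp only [Polynomial.map_mul, Polynomial.map_pow, Polynomial.map_C, Polynomial.map_X, MvPolynomial.eval₂Hom_X', hv]
  rw [Fin.sum_univ_eq_sum_range (fun i => Polynomial.C (f.coeff i) * Polynomial.X ^ i) N]
  exact (as_sum_range_C_mul_X_pow' f hf).symm

/-- **The witness: every Hurwitz determinant of `(1 + X)^M` is positive** (`k ≤ M`; all roots are `−1` — the Routh–Hurwitz theorem N211 in its ascending form). [this file, §940] -/
theorem det_hurwitzSeqMatrix_one_add_X_pow_pos (M : ℕ) {k : ℕ} (hk : k ≤ M) : 0 < (hurwitzSeqMatrix k ((1 + Polynomial.X : ℝ[X]) ^ M).coeff).det := by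
  have h1 : (1 + Polynomial.X : ℝ[X]).natDegree = 1 := by
    rw [show (1 + Polynomial.X : ℝ[X]) = Polynomial.X + C 1 by rw [map_one, add_comm], natDegree_X_add_C]
  have hdeg : ((1 + Polynomial.X : ℝ[X]) ^ M).natDegree = M := by rw [natDegree_pow, h1, mul_one]
  have h0 : 0 < ((1 + Polynomial.X : ℝ[X]) ^ M).coeff 0 := by rw [coeff_one_add_X_pow, Nat.choose_zero_right, Nat.cast_one]; exact one_pos
  refine (forall_re_neg_iff_forall_det_hurwitzSeqMatrix_pos hdeg h0).1 (fun z hz => ?_) k hk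
  rw [mem_roots', IsRoot.def, eval_map, eval₂_pow, eval₂_add, eval₂_one, eval₂_X] at hz
  have h1 : 1 + z = 0 := pow_eq_zero_iff (n := M) (by rintro rfl; simp at hz) |>.1 hz.2
  rw [show z = -1 by linear_combination h1]
  norm_num

/-- The generic `p = f(X²) + X g(X²)` over `ℤ[f_i, g_i]` (`i < N`) specialises, under `f_i ↦ C(2N−1, 2i)`, `g_i ↦ C(2N−1, 2i+1)` (the parts of `(1+X)^{2N−1}`), to `(1 + X)^{2N−1}`; hence **all its
Hurwitz determinants `Δ_k`, `k ≤ 2N − 1`, are non-zero polynomials**. [this file, §940] -/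
theorem det_hurwitzSeqMatrix_generic_ne_zero (N : ℕ) {k : ℕ} (hk : k ≤ 2 * N - 1) :
    (hurwitzSeqMatrix k (expand (MvPolynomial (Fin N ⊕ Fin N) ℤ) 2 (∑ i : Fin N, Polynomial.C (MvPolynomial.X (Sum.inl i)) * Polynomial.X ^ (i : ℕ))
        + Polynomial.X * expand (MvPolynomial (Fin N ⊕ Fin N) ℤ) 2 (∑ i : Fin N, Polynomial.C (MvPolynomial.X (Sum.inr i)) * Polynomial.X ^ (i : ℕ))).coeff).det ≠ 0 := by
  set q : ℝ[X] := (1 + Polynomial.X) ^ (2 * N - 1) with hq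
  -- the parts of `q`
  have hf : (contract 2 q).natDegree < N ∨ N = 0 := by
    rcases Nat.eq_zero_or_pos N with h | h
    · exact Or.inr h
    · refine Or.inl ((natDegree_le_iff_coeff_eq_zero.2 fun m hm => ?_).trans_lt (Nat.sub_lt h one_pos))
      rw [coeff_contract two_ne_zero, hq, coeff_one_add_X_pow, Nat.choose_eq_zero_of_lt (by omega), Nat.cast_zero]
  have hg : (contract 2 q.divX).natDegree < N ∨ N = 0 := by
    rcases Nat.eq_zero_or_pos N with h | h
    · exact Or.inr h
    · refine Or.inl ((natDegree_le_iff_coeff_eq_zero.2 fun m hm => ?_).trans_lt (Nat.sub_lt h one_pos))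
      rw [coeff_contract two_ne_zero, coeff_divX, hq, coeff_one_add_X_pow, Nat.choose_eq_zero_of_lt (by omega), Nat.cast_zero]
  rcases Nat.eq_zero_or_pos N with hN | hN
  · subst hN
    obtain rfl : k = 0 := by omega
    rw [Matrix.det_fin_zero]
    exact one_ne_zero
  set ψ : MvPolynomial (Fin N ⊕ Fin N) ℤ →+* ℝ := MvPolynomial.eval₂Hom (Int.castRingHom ℝ) (Sum.elim (fun i : Fin N => (contract 2 q).coeff i) (fun i : Fin N => (contract 2 q.divX).coeff i)) with hψ
  intro h
  have h' := congrArg ψ h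
  rw [map_zero, RingHom.map_det, RingHom.mapMatrix_apply, hurwitzSeqMatrix_map, ← coeff_map_eq_comp, map_expand_two_add_X_mul,
    map_sum_C_X_mul_X_pow_eq Sum.inl _ (contract 2 q) (hf.resolve_right (by omega)) (fun i => rfl), map_sum_C_X_mul_X_pow_eq Sum.inr _ (contract 2 q.divX) (hg.resolve_right (by omega)) (fun i => rfl),
    ← eq_expand_contract_add_X_mul_expand_contract q] at h'
  exact (det_hurwitzSeqMatrix_one_add_X_pow_pos (2 * N - 1) hk).ne' h'

/-- **The identities hold for the generic pair** (transport to the fraction field, where N220 applies). [this file, §940] -/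
theorem det_bezoutian_generic (N j : ℕ) (hj : j + 1 ≤ N) :
    (bezoutian j (∑ i : Fin N, Polynomial.C (MvPolynomial.X (Sum.inr i) : MvPolynomial (Fin N ⊕ Fin N) ℤ) * Polynomial.X ^ (i : ℕ))
          (∑ i : Fin N, Polynomial.C (MvPolynomial.X (Sum.inl i)) * Polynomial.X ^ (i : ℕ))).det
        = (hurwitzSeqMatrix (2 * j) (expand (MvPolynomial (Fin N ⊕ Fin N) ℤ) 2 (∑ i : Fin N, Polynomial.C (MvPolynomial.X (Sum.inl i)) * Polynomial.X ^ (i : ℕ))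
            + Polynomial.X * expand (MvPolynomial (Fin N ⊕ Fin N) ℤ) 2 (∑ i : Fin N, Polynomial.C (MvPolynomial.X (Sum.inr i)) * Polynomial.X ^ (i : ℕ))).coeff).det
      ∧ (bezoutian (j + 1) (∑ i : Fin N, Polynomial.C (MvPolynomial.X (Sum.inl i) : MvPolynomial (Fin N ⊕ Fin N) ℤ) * Polynomial.X ^ (i : ℕ))
          (Polynomial.X * ∑ i : Fin N, Polynomial.C (MvPolynomial.X (Sum.inr i)) * Polynomial.X ^ (i : ℕ))).det
        = (∑ i : Fin N, Polynomial.C (MvPolynomial.X (Sum.inl i) : MvPolynomial (Fin N ⊕ Fin N) ℤ) * Polynomial.X ^ (i : ℕ)).coeff 0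
          * (hurwitzSeqMatrix (2 * j + 1) (expand (MvPolynomial (Fin N ⊕ Fin N) ℤ) 2 (∑ i : Fin N, Polynomial.C (MvPolynomial.X (Sum.inl i)) * Polynomial.X ^ (i : ℕ))
            + Polynomial.X * expand (MvPolynomial (Fin N ⊕ Fin N) ℤ) 2 (∑ i : Fin N, Polynomial.C (MvPolynomial.X (Sum.inr i)) * Polynomial.X ^ (i : ℕ))).coeff).det := by
  set R := MvPolynomial (Fin N ⊕ Fin N) ℤ with hR
  set fg : R[X] := ∑ i : Fin N, Polynomial.C (MvPolynomial.X (Sum.inl i) : R) * Polynomial.X ^ (i : ℕ) with hfg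
  set gg : R[X] := ∑ i : Fin N, Polynomial.C (MvPolynomial.X (Sum.inr i) : R) * Polynomial.X ^ (i : ℕ) with hgg
  set ι : R →+* FractionRing R := algebraMap R (FractionRing R) with hι
  have hinj : Function.Injective ι := IsFractionRing.injective R (FractionRing R)
  -- regularity in the fraction field
  have hreg : ∀ k, 1 ≤ k → k ≤ 2 * j + 1 → (hurwitzSeqMatrix k (expand (FractionRing R) 2 (fg.map ι) + Polynomial.X * expand (FractionRing R) 2 (gg.map ι)).coeff).det ≠ 0 := by
    intro k _ hk h
    rw [← map_expand_two_add_X_mul, coeff_map_eq_comp, ← hurwitzSeqMatrix_map, ← RingHom.mapMatrix_apply, ← RingHom.map_det] at h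
    exact det_hurwitzSeqMatrix_generic_ne_zero N (k := k) (by omega) (hinj (by rw [h, map_zero]))
  have hE := det_bezoutian_even_odd_eq j (f := fg.map ι) (g := gg.map ι) fun k hk1 hk => hreg k hk1 (by omega)
  have hO := det_bezoutian_X_mul_eq j (f := fg.map ι) (g := gg.map ι) hreg
  rw [← map_expand_two_add_X_mul, coeff_map_eq_comp, ← hurwitzSeqMatrix_map, ← RingHom.mapMatrix_apply, ← RingHom.map_det, ← bezoutian_map, ← RingHom.mapMatrix_apply, ← RingHom.map_det] at hE
  have hXg : Polynomial.X * gg.map ι = (Polynomial.X * gg).map ι := by rw [Polynomial.map_mul, Polynomial.map_X]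
  rw [← map_expand_two_add_X_mul, coeff_map_eq_comp, coeff_map_eq_comp, ← hurwitzSeqMatrix_map, ← RingHom.mapMatrix_apply, ← RingHom.map_det, hXg, ← bezoutian_map,
    ← RingHom.mapMatrix_apply, ← RingHom.map_det, Function.comp_apply, ← map_mul] at hO
  exact ⟨hinj hE, hinj hO⟩

end Generic

/-! ## §941. The unconditional dictionary -/

section Dictionary

variable {K : Type*} [CommRing K]

/-- **THE HURWITZ DETERMINANTS OF EVEN ORDER ARE THE LEADING MINORS OF `B(g, f)`: `det B_j(g, f) = Δ_{2j}(f(X²) + X g(X²))` for all `f, g` over any commutative ring** (`Δ_k = det H_k` of the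
ascending coefficient sequence). [Gantmacher XV §6 + F–H Thm 5.55 (iii), by the generic point; this file, §941] -/
theorem det_bezoutian_eq_det_hurwitzSeqMatrix_two_mul (j : ℕ) (f g : K[X]) :
    (bezoutian j g f).det = (hurwitzSeqMatrix (2 * j) (expand K 2 f + Polynomial.X * expand K 2 g).coeff).det := by
  set N := max (j + 1) (max f.natDegree g.natDegree + 1) with hN
  have hgen := (det_bezoutian_generic N j (le_max_left _ _)).1
  set φ : MvPolynomial (Fin N ⊕ Fin N) ℤ →+* K := MvPolynomial.eval₂Hom (Int.castRingHom K) (Sum.elim (fun i : Fin N => f.coeff i) (fun i : Fin N => g.coeff i)) with hφ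
  have h := congrArg φ hgen
  rwa [RingHom.map_det, RingHom.mapMatrix_apply, bezoutian_map, RingHom.map_det, RingHom.mapMatrix_apply, hurwitzSeqMatrix_map, ← coeff_map_eq_comp, map_expand_two_add_X_mul,
    map_sum_C_X_mul_X_pow_eq Sum.inl _ f (by omega) (fun i => rfl), map_sum_C_X_mul_X_pow_eq Sum.inr _ g (by omega) (fun i => rfl)] at h

/-- **THE HURWITZ DETERMINANTS OF ODD ORDER ARE THE LEADING MINORS OF `B(f, X·g)` UP TO `f_0`: `det B_{j+1}(f, X·g) = f_0 · Δ_{2j+1}(f(X²) + X g(X²))` for all `f, g` over any commutative ring.**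
[Gantmacher XV §6 + F–H Thm 5.55 (iii), by the generic point; this file, §941] -/
theorem det_bezoutian_X_mul_eq_coeff_zero_mul_det_hurwitzSeqMatrix (j : ℕ) (f g : K[X]) :
    (bezoutian (j + 1) f (Polynomial.X * g)).det = f.coeff 0 * (hurwitzSeqMatrix (2 * j + 1) (expand K 2 f + Polynomial.X * expand K 2 g).coeff).det := by
  set N := max (j + 1) (max f.natDegree g.natDegree + 1) with hN
  have hgen := (det_bezoutian_generic N j (le_max_left _ _)).2
  set φ : MvPolynomial (Fin N ⊕ Fin N) ℤ →+* K := MvPolynomial.eval₂Hom (Int.castRingHom K) (Sum.elim (fun i : Fin N => f.coeff i) (fun i : Fin N => g.coeff i)) with hφ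
  have h := congrArg φ hgen
  rwa [RingHom.map_det, RingHom.mapMatrix_apply, bezoutian_map, Polynomial.map_mul, Polynomial.map_X, map_mul, ← coeff_map, RingHom.map_det, RingHom.mapMatrix_apply, hurwitzSeqMatrix_map,
    ← coeff_map_eq_comp, map_expand_two_add_X_mul, map_sum_C_X_mul_X_pow_eq Sum.inl _ f (by omega) (fun i => rfl), map_sum_C_X_mul_X_pow_eq Sum.inr _ g (by omega) (fun i => rfl)] at h

end Dictionary

end Summit.Ventures.HSemireg.Wedge.HankelOuter
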